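import Summits.AtomisticToContinuum.Crystallization.Theses.ChessboardParticlePlanes
import Summits.AtomisticToContinuum.Crystallization.Theorems.ChessboardParticlePlanesLjPlaneChessboardLatticeForm

/-!
# Crux `ChessboardParticlePlanes.LjPlaneChessboard` (stmt-AtomisticToContinuum-6709), line `Sketch`,
# stub `matrixLatticeFormNonneg` — a matrix kernel with positive semi-definite Fourier transform has
# a non-negative lattice-periodised Hermitian form

Let `V` be a `2`-dimensional real inner-product space, `L ⊂ V` a full lattice with dual lattice
`L* = dualLattice L`, and `k_{jj'} : V → ℂ` (`j, j' < N`) continuous kernels with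
`‖k_{jj'}(x)‖ ≤ C (1 + ‖x‖)⁻³` and `𝓕k_{jj'}` summable over `L*`, such that for every `w ∈ V` the
matrix `(𝓕k_{jj'}(w))_{jj'}` is Hermitian positive semi-definite, i.e. the form
`∑_{j,j'} conj(c_j) 𝓕k_{jj'}(w) c_{j'}` is real and `≥ 0` for every `c ∈ ℂ^N`.  Then for all point
families `p_{ja} ∈ V` and weights `s_{ja} ∈ ℂ` (`a < M`) the periodised form
`∑_{j,j',a,b} conj(s_{ja}) s_{j'b} ∑_{l ∈ L} k_{jj'}(p_{ja} - p_{j'b} + l)` is real and `≥ 0`.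

Proof (Bochner positivity through Poisson summation, matrix version of `latticeFormNonneg`).
* Positive semi-definiteness dominates the off-diagonal entries by the diagonal ones,
  `‖A_{jj'}‖ ≤ A_{jj} + A_{j'j'}` (`matrixLatticeForm_norm_le_diag`, from the form at the vectors
  `e_j + β e_{j'}`, `β ∈ {±1, ±i}`); the diagonal transforms are real `≥ 0` and summable, so every
  `𝓕k_{jj'}` is absolutely summable over `L*`.
* For `z ∈ V` the translate `v ↦ k_{jj'}(z + v)` is continuous with decay exponent `3 > 2 = dim V`
  (`latticeForm_norm_translate_le`) and `𝓕[k_{jj'}(z + ·)](w) = 𝐞(⟪z, w⟫) 𝓕k_{jj'}(w)`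
  (`matrixLatticeForm_fourier_translate`), so the tree's Poisson summation formula
  (`Literature.NumberTheory.LFunctions.Fourier.tsum_eq_tsum_fourier_of_rpow_decay`) gives
  `∑_{l ∈ L} k_{jj'}(z + l) = vol(L)⁻¹ ∑_{w ∈ L*} 𝐞(⟪z, w⟫) 𝓕k_{jj'}(w)`
  (`matrixLatticeForm_hasSum_periodise`).
* Summing over `(j, j', a, b)` with weights `conj(s_{ja}) s_{j'b}` and splitting the unitary
  character `𝐞(⟪p_{ja} - p_{j'b}, w⟫) = 𝐞(⟪p_{ja}, w⟫) conj 𝐞(⟪p_{j'b}, w⟫)`, the term of the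
  resulting series at `w ∈ L*` is `vol(L)⁻¹ ∑_{j,j'} conj(c_j) 𝓕k_{jj'}(w) c_{j'}` with
  `c_j = ∑_a s_{ja} conj 𝐞(⟪p_{ja}, w⟫)` (`matrixLatticeForm_regroup`), which is real and `≥ 0` by
  hypothesis; hence so is the sum.
[folklore]
-/

noncomputable section

namespace Summit.AtomisticToContinuum.Crystallization.Theorems.ChessboardParticlePlanesLjPlaneChessboard

open Literature.Algebra.EuclideanLattices
open scoped Real InnerProductSpace FourierTransform ComplexConjugate

section PositiveSemidefinite

variable {N : ℕ}

/-- The sesquilinear pairing `∑_{i,i'} conj(u_i) A_{ii'} v_{i'}` of two one-point vectors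
`u = α e_j`, `v = β e_{j'}` is `conj(α) A_{jj'} β`. [folklore] -/
theorem matrixLatticeForm_pair_single (A : Fin N → Fin N → ℂ) (j j' : Fin N) (α β : ℂ) :
    (∑ i, ∑ i', conj ((Pi.single j α : Fin N → ℂ) i) * A i i' *
        (Pi.single j' β : Fin N → ℂ) i') = conj α * A j j' * β := by
  have h1 : ∀ i : Fin N, (∑ i', conj ((Pi.single j α : Fin N → ℂ) i) * A i i' *
      (Pi.single j' β : Fin N → ℂ) i') = conj ((Pi.single j α : Fin N → ℂ) i) * A i j' * β := by
    intro i
    rw [Fintype.sum_eq_single j']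
    · rw [Pi.single_eq_same]
    · intro i' hi'
      rw [Pi.single_eq_of_ne hi', mul_zero]
  simp_rw [h1]
  rw [Fintype.sum_eq_single j]
  · rw [Pi.single_eq_same]
  · intro i hi
    rw [Pi.single_eq_of_ne hi, map_zero, zero_mul, zero_mul]

/-- Sesquilinear expansion of the form `Q(c) = ∑_{i,i'} conj(c_i) A_{ii'} c_{i'}` at a sum:
`Q(u + v) = B(u,u) + B(u,v) + B(v,u) + B(v,v)`. [folklore] -/
theorem matrixLatticeForm_form_add (A : Fin N → Fin N → ℂ) (u v : Fin N → ℂ) :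
    (∑ i, ∑ i', conj ((u + v) i) * A i i' * (u + v) i') =
      (∑ i, ∑ i', conj (u i) * A i i' * u i') + (∑ i, ∑ i', conj (u i) * A i i' * v i') +
        ((∑ i, ∑ i', conj (v i) * A i i' * u i') + (∑ i, ∑ i', conj (v i) * A i i' * v i')) := by
  simp only [Pi.add_apply, map_add, add_mul, mul_add, Finset.sum_add_distrib]
  ring

/-- **Off-diagonal domination for positive semi-definite Hermitian matrices**: if the form
`∑_{j,j'} conj(c_j) A_{jj'} c_{j'}` is real and `≥ 0` for every `c`, then
`‖A_{jj'}‖ ≤ Re A_{jj} + Re A_{j'j'}`.  From the form at `e_j` (diagonal entries real `≥ 0`) and at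
`e_j + β e_{j'}` for `β ∈ {1, -1, i, -i}` (which give `A_{j'j} = conj A_{jj'}` and
`2 |Re A_{jj'}|, 2 |Im A_{jj'}| ≤ Re A_{jj} + Re A_{j'j'}`). [folklore] -/
theorem matrixLatticeForm_norm_le_diag (A : Fin N → Fin N → ℂ)
    (hA : ∀ c : Fin N → ℂ, 0 ≤ (∑ j, ∑ j', conj (c j) * A j j' * c j').re ∧
      (∑ j, ∑ j', conj (c j) * A j j' * c j').im = 0) (j j' : Fin N) :
    ‖A j j'‖ ≤ (A j j).re + (A j' j').re := by
  -- diagonal entries are real and non-negative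
  have hdiag : ∀ i : Fin N, 0 ≤ (A i i).re ∧ (A i i).im = 0 := by
    intro i
    have h := hA (Pi.single i 1)
    rw [matrixLatticeForm_pair_single, map_one, one_mul, mul_one] at h
    exact h
  rcases eq_or_ne j j' with rfl | hjj'
  · -- `‖A_{jj}‖ = Re A_{jj}`
    obtain ⟨hre, him⟩ := hdiag j
    have h : ‖A j j‖ = (A j j).re := by
      rw [← Complex.re_add_im (A j j), him, Complex.ofReal_zero, zero_mul, add_zero,
        Complex.norm_real, Real.norm_eq_abs, abs_of_nonneg hre, Complex.ofReal_re]
    rw [h]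
    exact le_add_of_nonneg_right hre
  · -- the form at `e_j + β e_{j'}`
    have hq : ∀ β : ℂ,
        0 ≤ (A j j + A j j' * β + (conj β * A j' j + conj β * A j' j' * β)).re ∧
          (A j j + A j j' * β + (conj β * A j' j + conj β * A j' j' * β)).im = 0 := by
      intro β
      have h := hA (Pi.single j 1 + Pi.single j' β)
      rw [matrixLatticeForm_form_add, matrixLatticeForm_pair_single, matrixLatticeForm_pair_single,
        matrixLatticeForm_pair_single, matrixLatticeForm_pair_single, map_one, one_mul, one_mul,
        mul_one, mul_one] at h
      exact h
    obtain ⟨hjre, hjim⟩ := hdiag j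
    obtain ⟨hj're, hj'im⟩ := hdiag j'
    have h1 := hq 1
    have h2 := hq (-1)
    have h3 := hq Complex.I
    have h4 := hq (-Complex.I)
    simp only [map_one, map_neg, Complex.conj_I, neg_neg, mul_one, one_mul, mul_neg, neg_mul,
      Complex.add_re, Complex.add_im, Complex.neg_re, Complex.neg_im, Complex.mul_re,
      Complex.mul_im, Complex.I_re, Complex.I_im, mul_zero, zero_mul, zero_sub, add_zero,
      zero_add] at h1 h2 h3 h4
    have hre : |(A j j').re| ≤ ((A j j).re + (A j' j').re) / 2 :=
      abs_le.2 ⟨by linarith [h1.1, h2.1, h3.2], by linarith [h1.1, h2.1, h3.2]⟩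
    have him : |(A j j').im| ≤ ((A j j).re + (A j' j').re) / 2 :=
      abs_le.2 ⟨by linarith [h3.1, h4.1, h1.2], by linarith [h3.1, h4.1, h1.2]⟩
    calc ‖A j j'‖ ≤ |(A j j').re| + |(A j j').im| := Complex.norm_le_abs_re_add_abs_im _
      _ ≤ (A j j).re + (A j' j').re := by linarith

end PositiveSemidefinite

section Regroup

variable {V : Type*} [NormedAddCommGroup V] [InnerProductSpace ℝ V]

/-- The Fourier character is unitary: `𝐞(⟪x - y, w⟫) = 𝐞(⟪x, w⟫) conj 𝐞(⟪y, w⟫)`. [folklore] -/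
theorem matrixLatticeForm_fourierChar_sub (x y w : V) :
    ((𝐞 (⟪x - y, w⟫_ℝ) : Circle) : ℂ) = (𝐞 (⟪x, w⟫_ℝ) : ℂ) * conj ((𝐞 (⟪y, w⟫_ℝ) : Circle) : ℂ) := by
  rw [inner_sub_left, sub_eq_add_neg, AddChar.map_add_eq_mul, AddChar.map_neg_eq_inv,
    Circle.coe_mul, Circle.coe_inv_eq_conj]

/-- **Regrouping the phases**: with `c_j = ∑_a s_{ja} conj 𝐞(⟪p_{ja}, w⟫)`,
`∑_{j,j',a,b} conj(s_{ja}) s_{j'b} · r 𝐞(⟪p_{ja} - p_{j'b}, w⟫) F_{jj'} = r ∑_{j,j'} conj(c_j) F_{jj'} c_{j'}`.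
[folklore] -/
theorem matrixLatticeForm_regroup {N M : ℕ} (F : Fin N → Fin N → ℂ) (p : Fin N → Fin M → V)
    (s : Fin N → Fin M → ℂ) (r : ℂ) (w : V) :
    ∑ j, ∑ j', ∑ a, ∑ b, conj (s j a) * s j' b *
        (r * (((𝐞 (⟪p j a - p j' b, w⟫_ℝ) : Circle) : ℂ) * F j j')) =
      r * ∑ j, ∑ j', conj (∑ a, s j a * conj (((𝐞 (⟪p j a, w⟫_ℝ)) : Circle) : ℂ)) * F j j' *
        ∑ b, s j' b * conj (((𝐞 (⟪p j' b, w⟫_ℝ)) : Circle) : ℂ) := by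
  rw [Finset.mul_sum]
  refine Finset.sum_congr rfl fun j _ => ?_
  rw [Finset.mul_sum]
  refine Finset.sum_congr rfl fun j' _ => ?_
  rw [map_sum, Finset.sum_mul, Finset.sum_mul_sum, Finset.mul_sum]
  refine Finset.sum_congr rfl fun a _ => ?_
  rw [Finset.mul_sum]
  refine Finset.sum_congr rfl fun b _ => ?_
  rw [matrixLatticeForm_fourierChar_sub, map_mul, Complex.conj_conj]
  ring

end Regroup

section Translate

variable {V : Type*} [NormedAddCommGroup V]

/-- Decay of a translate of a complex kernel: if `‖f(x)‖ ≤ C (1 + ‖x‖)⁻³` then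
`‖f(z + v)‖ ≤ C (1 + ‖z‖)³ (1 + ‖v‖)⁻³` (`latticeForm_norm_translate_le` applied to `‖f‖`).
[folklore] -/
theorem matrixLatticeForm_norm_translate_le {f : V → ℂ} {C : ℝ}
    (hdec : ∀ x : V, ‖f x‖ ≤ C * (1 + ‖x‖) ^ (-(3 : ℝ))) (z v : V) :
    ‖f (z + v)‖ ≤ C * (1 + ‖z‖) ^ (3 : ℝ) * (1 + ‖v‖) ^ (-(3 : ℝ)) := by
  have h := latticeForm_norm_translate_le (k := fun x => ‖f x‖) (C := C)
    (fun x => by rw [abs_norm]; exact hdec x) z v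
  rwa [Complex.norm_real, norm_norm] at h

end Translate

section Periodise

variable {V : Type*} [NormedAddCommGroup V] [InnerProductSpace ℝ V] [FiniteDimensional ℝ V]
  [MeasurableSpace V] [BorelSpace V]

/-- The Fourier transform converts translation into a phase (complex-valued version of
`latticeForm_fourier_translate`): `𝓕[f(z + ·)](w) = 𝐞(⟪z, w⟫) 𝓕f(w)` (Mathlib's
`VectorFourier.fourierIntegral_comp_add_right`). [folklore] -/
theorem matrixLatticeForm_fourier_translate (f : V → ℂ) (z w : V) :
    𝓕 (fun v : V => f (z + v)) w = 𝐞 (⟪z, w⟫_ℝ) • 𝓕 f w := by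
  have hF : (fun v : V => f (z + v)) = f ∘ fun v => v + z := by
    funext v
    simp only [Function.comp_apply, add_comm]
  rw [hF]
  have key := VectorFourier.fourierIntegral_comp_add_right 𝐞
    (MeasureTheory.volume : MeasureTheory.Measure V) (innerₗ V) f z
  change VectorFourier.fourierIntegral 𝐞 MeasureTheory.volume (innerₗ V) (f ∘ fun v => v + z) w =
    𝐞 (⟪z, w⟫_ℝ) • VectorFourier.fourierIntegral 𝐞 MeasureTheory.volume (innerₗ V) f w
  rw [key]
  simp only [innerₗ_apply_apply]

/-- **Periodisation of a translate through Poisson summation** (complex form): for a full lattice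
`L` in the plane `V`, `f : V → ℂ` continuous with `‖f(x)‖ ≤ C (1 + ‖x‖)⁻³` and `𝓕f` absolutely
summable over `L*`, `∑_{l ∈ L} f(z + l) = vol(L)⁻¹ ∑_{w ∈ L*} 𝐞(⟪z, w⟫) 𝓕f(w)` as a `HasSum`
statement (the tree's `tsum_eq_tsum_fourier_of_rpow_decay` applied to `f(z + ·)`). [folklore] -/
theorem matrixLatticeForm_hasSum_periodise (L : Submodule ℤ V) [DiscreteTopology L]
    [IsZLattice ℝ L] {f : V → ℂ} {C : ℝ} (hV : Module.finrank ℝ V = 2) (hf : Continuous f)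
    (hdec : ∀ x : V, ‖f x‖ ≤ C * (1 + ‖x‖) ^ (-(3 : ℝ)))
    (hnorm : Summable (fun w : dualLattice L => ‖𝓕 f (w : V)‖)) (z : V) :
    HasSum (fun w : dualLattice L => ((ZLattice.covolume L : ℝ) : ℂ)⁻¹ *
        ((((𝐞 (⟪z, (w : V)⟫_ℝ)) : Circle) : ℂ) * 𝓕 f (w : V)))
      (∑' l : L, f (z + (l : V))) := by
  -- the translate `f_z = f(z + ·)`: continuity and decay with exponent `3 > 2 = dim V`
  have hcont : Continuous fun v : V => f (z + v) := hf.comp (continuous_const.add continuous_id)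
  have hb : (Module.finrank ℝ V : ℝ) < 3 := by rw [hV]; norm_num
  have hdec' : ∀ v : V, ‖f (z + v)‖ ≤ C * (1 + ‖z‖) ^ (3 : ℝ) * (1 + ‖v‖) ^ (-(3 : ℝ)) :=
    matrixLatticeForm_norm_translate_le hdec z
  -- `𝓕 f_z = 𝐞(⟪z, ·⟫) 𝓕f` is summable over `L*`
  have hfour : ∀ w : V, 𝓕 (fun v : V => f (z + v)) w = 𝐞 (⟪z, w⟫_ℝ) • 𝓕 f w :=
    matrixLatticeForm_fourier_translate f z
  have hsumf : Summable fun w : dualLattice L => 𝓕 (fun v : V => f (z + v)) (w : V) := by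
    simp_rw [hfour]
    refine Summable.of_norm (hnorm.congr fun w => ?_)
    rw [Circle.norm_smul]
  -- Poisson summation for `f_z`
  have key := Literature.NumberTheory.LFunctions.Fourier.tsum_eq_tsum_fourier_of_rpow_decay L
    hcont hb hdec' hsumf
  have h1 : HasSum (fun w : dualLattice L =>
      ((ZLattice.covolume L)⁻¹ : ℝ) • 𝓕 (fun v : V => f (z + v)) (w : V))
      (∑' l : L, f (z + (l : V))) := by
    rw [key]
    exact hsumf.hasSum.const_smul _
  have hfun : (fun w : dualLattice L =>
      ((ZLattice.covolume L)⁻¹ : ℝ) • 𝓕 (fun v : V => f (z + v)) (w : V)) =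
      fun w : dualLattice L => ((ZLattice.covolume L : ℝ) : ℂ)⁻¹ *
        ((((𝐞 (⟪z, (w : V)⟫_ℝ)) : Circle) : ℂ) * 𝓕 f (w : V)) := by
    funext w
    rw [hfour, Complex.real_smul, Circle.smul_def, Complex.ofReal_inv, smul_eq_mul]
  rw [hfun] at h1
  exact h1

end Periodise

/-- **A matrix kernel with positive semi-definite Fourier transform has a non-negative
lattice-periodised Hermitian form** (stub `matrixLatticeFormNonneg` of line `Sketch`): for a full
lattice `L` in a `2`-dimensional real inner-product space `V` and continuous kernels
`k_{jj'} : V → ℂ` with `‖k_{jj'}(x)‖ ≤ C (1 + ‖x‖)⁻³`, `𝓕k_{jj'}` summable over `L*` and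
`(𝓕k_{jj'}(w))_{jj'}` Hermitian positive semi-definite for every `w`, every finite weighted point
family `(p_{ja}, s_{ja})` satisfies
`∑_{j,j',a,b} conj(s_{ja}) s_{j'b} ∑_{l ∈ L} k_{jj'}(p_{ja} - p_{j'b} + l) ∈ [0, ∞)`; indeed the left
side equals `vol(L)⁻¹ ∑_{w ∈ L*} ∑_{j,j'} conj(c_j(w)) 𝓕k_{jj'}(w) c_{j'}(w)` with
`c_j(w) = ∑_a s_{ja} conj 𝐞(⟪p_{ja}, w⟫)`, by Poisson summation
(`matrixLatticeForm_hasSum_periodise`) and `matrixLatticeForm_regroup`. [folklore] -/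
theorem matrixLatticeFormNonneg :
    ∀ (V : Type) [NormedAddCommGroup V] [InnerProductSpace ℝ V] [FiniteDimensional ℝ V]
      [MeasurableSpace V] [BorelSpace V] (L : Submodule ℤ V) [DiscreteTopology L] [IsZLattice ℝ L]
      (N : ℕ) (k : Fin N → Fin N → V → ℂ) (C : ℝ), Module.finrank ℝ V = 2 →
      (∀ j j', Continuous (k j j')) →
      (∀ j j' (x : V), ‖k j j' x‖ ≤ C * (1 + ‖x‖) ^ (-(3 : ℝ))) →
      (∀ j j', Summable (fun w : dualLattice L => 𝓕 (k j j') (w : V))) →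
      (∀ (w : V) (c : Fin N → ℂ),
        0 ≤ (∑ j, ∑ j', conj (c j) * 𝓕 (k j j') w * c j').re ∧
        (∑ j, ∑ j', conj (c j) * 𝓕 (k j j') w * c j').im = 0) →
      ∀ (M : ℕ) (p : Fin N → Fin M → V) (s : Fin N → Fin M → ℂ),
        0 ≤ (∑ j, ∑ j', ∑ a, ∑ b,
              conj (s j a) * s j' b * ∑' l : L, k j j' (p j a - p j' b + (l : V))).re ∧
        (∑ j, ∑ j', ∑ a, ∑ b,
              conj (s j a) * s j' b * ∑' l : L, k j j' (p j a - p j' b + (l : V))).im = 0 := by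
  intro V _ _ _ _ _ L _ _ N k C hV hk hdec hsum hA M p s
  -- absolute summability of every `𝓕 k_{jj'}` over `L*`, by positive semi-definite domination
  have hre : ∀ j : Fin N, Summable fun w : dualLattice L => (𝓕 (k j j) (w : V)).re := fun j =>
    (Complex.hasSum_re (hsum j j).hasSum).summable
  have hnorm : ∀ j j' : Fin N, Summable fun w : dualLattice L => ‖𝓕 (k j j') (w : V)‖ :=
    fun j j' => Summable.of_nonneg_of_le (fun w => norm_nonneg _)
      (fun w => matrixLatticeForm_norm_le_diag (fun i i' => 𝓕 (k i i') (w : V)) (hA (w : V)) j j')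
      ((hre j).add (hre j'))
  -- each pair of points: the periodised translate as a series over `L*`
  have key : ∀ (j j' : Fin N) (a b : Fin M), HasSum (fun w : dualLattice L =>
      conj (s j a) * s j' b * (((ZLattice.covolume L : ℝ) : ℂ)⁻¹ *
        ((((𝐞 (⟪p j a - p j' b, (w : V)⟫_ℝ)) : Circle) : ℂ) * 𝓕 (k j j') (w : V))))
      (conj (s j a) * s j' b * ∑' l : L, k j j' (p j a - p j' b + (l : V))) :=
    fun j j' a b => (matrixLatticeForm_hasSum_periodise L hV (hk j j') (hdec j j') (hnorm j j')
      (p j a - p j' b)).mul_left _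
  -- the whole form as one series over `L*`
  have htot : HasSum (fun w : dualLattice L => ∑ j, ∑ j', ∑ a, ∑ b,
      conj (s j a) * s j' b * (((ZLattice.covolume L : ℝ) : ℂ)⁻¹ *
        ((((𝐞 (⟪p j a - p j' b, (w : V)⟫_ℝ)) : Circle) : ℂ) * 𝓕 (k j j') (w : V))))
      (∑ j, ∑ j', ∑ a, ∑ b,
        conj (s j a) * s j' b * ∑' l : L, k j j' (p j a - p j' b + (l : V))) :=
    hasSum_sum fun j _ => hasSum_sum fun j' _ => hasSum_sum fun a _ => hasSum_sum fun b _ =>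
      key j j' a b
  -- whose terms are real and non-negative
  have hpos : ∀ w : dualLattice L,
      0 ≤ (∑ j, ∑ j', ∑ a, ∑ b, conj (s j a) * s j' b * (((ZLattice.covolume L : ℝ) : ℂ)⁻¹ *
          ((((𝐞 (⟪p j a - p j' b, (w : V)⟫_ℝ)) : Circle) : ℂ) * 𝓕 (k j j') (w : V)))).re ∧
        (∑ j, ∑ j', ∑ a, ∑ b, conj (s j a) * s j' b * (((ZLattice.covolume L : ℝ) : ℂ)⁻¹ *
          ((((𝐞 (⟪p j a - p j' b, (w : V)⟫_ℝ)) : Circle) : ℂ) * 𝓕 (k j j') (w : V)))).im = 0 := by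
    intro w
    rw [matrixLatticeForm_regroup (fun i i' => 𝓕 (k i i') (w : V)) p s _ (w : V),
      ← Complex.ofReal_inv, Complex.re_ofReal_mul, Complex.im_ofReal_mul]
    obtain ⟨h1, h2⟩ := hA (w : V)
      (fun j => ∑ a, s j a * conj (((𝐞 (⟪p j a, (w : V)⟫_ℝ)) : Circle) : ℂ))
    exact ⟨mul_nonneg (inv_nonneg.2 (ZLattice.covolume_pos L MeasureTheory.volume).le) h1,
      by rw [h2, mul_zero]⟩
  refine ⟨(Complex.hasSum_re htot).nonneg fun w => (hpos w).1, ?_⟩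
  have him := Complex.hasSum_im htot
  have hzero : (fun w : dualLattice L => (∑ j, ∑ j', ∑ a, ∑ b, conj (s j a) * s j' b *
      (((ZLattice.covolume L : ℝ) : ℂ)⁻¹ *
        ((((𝐞 (⟪p j a - p j' b, (w : V)⟫_ℝ)) : Circle) : ℂ) * 𝓕 (k j j') (w : V)))).im) =
      fun _ => 0 := funext fun w => (hpos w).2
  rw [hzero] at him
  exact him.unique hasSum_zero

end Summit.AtomisticToContinuum.Crystallization.Theorems.ChessboardParticlePlanesLjPlaneChessboard

end
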